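import Mathlib.Data.Matrix.ColumnRowPartitioned
import Mathlib.Algebra.Field.ZMod
import Mathlib.LinearAlgebra.Matrix.Kronecker
import Mathlib.LinearAlgebra.Matrix.Rank
import Literature.InformationTheory.Coding.DualDistance
import HarnessLib

/-!
# The hypergraph product (Tillich–Zémor) of two binary parity-check matrices and its parameters

Source: J.-P. Tillich, G. Zémor, *Quantum LDPC codes with positive rate and minimum distance
proportional to n^{1/2}*, IEEE Trans. Inform. Theory 60 (2014) 1193–1202 = arXiv:0903.0566
[TillichZemor2014]. The HELD text is arXiv:0903.0566v1 (2009; `lit read paper:arxiv-0903.0566`,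
chunks p0003–p0009); every locator below ("§", "Thm", "chunk pNNNN Lnn") refers to that text and its
numbering (Thm 1, Prop 2–6, Thm 7, Cor 8, Thm 9, Lemma 10). Matrix ("algebraic") form of the same
construction: A. A. Kovalev, L. P. Pryadko, ISIT 2012 = arXiv:1202.0928, §IV-A eq. (7)
[KovalevPryadko2012] (held, chunk p0007). The one-line modern summary
"`[[n₁n₂ + r₁r₂, k₁k₂, min{d₁,d₂}]]` from two classical `[nᵢ,kᵢ,dᵢ]`-codes with `rᵢ` linearly independent
checks" is Breuckmann–Eberhardt, PRX Quantum 2 (2021) 040101 = arXiv:2103.06309, §4.1 (held, chunk p0009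
L21) [BreuckmannEberhardt2021] — a special case, recorded here only in this docstring.

## What is here (LADDER-QEC row type-04; column words in each docstring)

* `pcCode H` — the binary linear code with parity-check matrix `H` (TZ: the *cycle code* `Z(ℋ)` of the
  hypergraph `ℋ` whose vertex–edge incidence matrix is `H`, §3 chunk p0006), `rowSpace H` — its dual,
  the row space of `H` (TZ: the *cocycle code*); DEFINITIONS.
* `cssMinDist HX HZ : ℕ∞` — the minimum distance of the CSS code with check matrices `HX`, `HZ` exactly as
  printed in TZ §2 (chunk p0004 L1–18): the least weight of a vector of `ker HX ∖ rowSpace HZ` or of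
  `ker HZ ∖ rowSpace HX` (`⊤` when there is none — TZ §5: "the minimum distance of a code reduced to the
  all-zero codeword is ∞"); DEFINITION. The CSS dimension `k = n − dim C_X^⊥ − dim C_Z^⊥` (loc. cit.) is
  used ADDITIVELY below (`card − rank HX − rank HZ` over `ℤ`), never as a truncated `ℕ` subtraction.
* `HypergraphProduct.xMatrix H₁ H₂`, `HypergraphProduct.zMatrix H₁ H₂` — the two check matrices of the
  quantum code `Q_ℋ` of the PRODUCT HYPERGRAPH `ℋ = ℋ₁·ℋ₂` (TZ §3 chunk p0006 L56–90, §4 chunk p0007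
  L1–12): `H_X` = vertex–edge incidence matrix, `H_Z` = chamber–edge incidence matrix, written as
  Kronecker block matrices; DEFINITIONS (computable).
  CONVENTION (read this before using): `Hᵢ : Matrix Vᵢ Eᵢ (ZMod 2)` is the incidence matrix of `ℋᵢ`
  (rows = vertices, columns = edges = bits of the classical code `ker Hᵢ`); qubits = edges of `ℋ` =
  `(E₁ × V₂) ⊕ (V₁ × E₂)` (the paper's `E_R ∪ E_L`, `|E| = |V₂||E₁| + |V₁||E₂|`, chunk p0006 L74);
  `H_X = [H₁ ⊗ 1 | 1 ⊗ H₂]` (rows `V₁ × V₂` = vertices), `H_Z = [1 ⊗ H₂ᵀ | H₁ᵀ ⊗ 1]` (rows `E₁ × E₂` =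
  chambers). The "modern" hypergraph product `HGP(A,B)` of two parity-check matrices `A` (`m_A × n_A`),
  `B` (`m_B × n_B`) — qubits `n_A n_B + m_A m_B`, `H_X = [A ⊗ 1 | 1 ⊗ Bᵀ]`, `H_Z = [1 ⊗ B | Aᵀ ⊗ 1]` — is,
  in this labelling, the code of `ℋ_A·(ℋ_B)ᵀ` (second hypergraph = TRANSPOSE hypergraph of `B`), i.e.
  LITERALLY `xMatrix A Bᵀ`, `zMatrix A Bᵀ` (TZ §6 itself takes `ℋ₂ = ℋ₁ᵀ`). When transporting the
  statements below to `HGP(A,B)`, read `k = k_A`, `r = k_Aᵀ`, `h = k_Bᵀ`, `s = k_B`, `d₁ = d_A`,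
  `d₁ᵀ = d_Aᵀ`, `d₂ = d_Bᵀ`, `d₂ᵀ = d_B` (so Thm 7 reads `dim = k_A k_B + k_Aᵀ k_Bᵀ`).
* `HypergraphProduct.xMatrix_mul_zMatrix_transpose` — `H_X H_Zᵀ = 0` (TZ Prop. 3: `C_Z^⊥ ⊂ Z(ℋ) = C_X`);
  PROVED, with the two inclusions `rowSpace H_Z ≤ ker H_X`, `rowSpace H_X ≤ ker H_Z`.
* `HypergraphProduct.dimension_eq` (TZ Thm 7), `….minDist_ge` (TZ Thm 9), `….minDist_le` (TZ Lemma 10),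
  `….mainTheorem` (TZ Thm 1 = §6: full-rank `H`, `ℋ₂ = ℋ₁ᵀ`, parameters `[[n² + (n−k)², k², d]]`) —
  CITED FACTS (`def … : Prop`, D-0014), typed AS PRINTED: Theorem 9 is the INEQUALITY
  `D ≥ min(d₁,d₂,d₁ᵀ,d₂ᵀ)`; the equality `D = min(…)` is NOT a printed theorem in general (only Lemma 10's
  upper bounds under its finiteness hypotheses, and `D = d` in the special case of Theorem 1);
  `TillichZemor2014_hgp_parameters` = the conjunction Thm 7 ∧ Thm 9 ∧ Lemma 10 (the "parameters of the
  hypergraph product" as one named fact).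

## Not here
Proofs of Theorems 7/9 and Lemma 10 (linear algebra resp. the paper's restriction/duality arguments —
wave 1 of the ladder; when they land, `theorem dimension_eq_holds : dimension_eq` etc. discharge the facts);
the row/column-weight bookkeeping of §4 (LDPC-ness); `q`-ary / chain-complex (Künneth) generalisations;
stabilizer-formalism objects (Pauli group, code space, the symplectic `[[n,k,d]]` predicate of
`Literature.InformationTheory.QuantumCodes.IsAdditiveCode`) — the facts here are statements about
`𝔽₂`-matrices and need none of them; the bridge "CSS pair `(H_X,H_Z)` ↦ additive code `rowSpace H_X ×
rowSpace H_Z` with the same `k` and distance" belongs with the CSS construction (CRSS Thm 9), not here.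
-/

namespace Literature.InformationTheory.QuantumCodes

open Matrix
open scoped Kronecker

/-! ### Classical side: the code of a parity-check matrix, its row space, CSS minimum distance -/

section CSS

variable {F : Type*} [Field F] [DecidableEq F]
variable {r r' q : Type*} [Fintype r] [Fintype r'] [Fintype q]

/-- The linear code with parity-check matrix `H`: `{x | H x = 0} = ker H` (TZ: the cycle code `Z(ℋ)` of
the hypergraph with incidence matrix `H` — "simply the code whose parity-check matrix is `H`"); definition.
[cite: TillichZemor2014, §3 (arXiv v1 chunk p0006 L29-33)] -/
def pcCode (H : Matrix r q F) : Submodule F (q → F) :=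
  LinearMap.ker H.mulVecLin

/-- The row space of `H` (all `F`-linear combinations of its rows) = the dual `C^⊥` of the code `C` with
parity-check matrix `H` (TZ: the cocycle code, "the dual code `Z(ℋ)^⊥` of `Z(ℋ)`"); definition.
[cite: TillichZemor2014, §2 and §3 (arXiv v1 chunk p0004 L4-8, p0006 L35-39)] -/
def rowSpace (H : Matrix r q F) : Submodule F (q → F) :=
  LinearMap.range H.vecMulLinear

omit [DecidableEq F] [Fintype r] in
/-- Membership in the code of `H` is `H *ᵥ x = 0`. [cite: TillichZemor2014, §3 (arXiv v1 chunk p0006 L29-33)] -/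
theorem mem_pcCode_iff (H : Matrix r q F) (x : q → F) : x ∈ pcCode H ↔ H *ᵥ x = 0 := Iff.rfl

omit [DecidableEq F] [Fintype q] in
/-- Membership in the row space of `H`: `x = yH` for some row vector `y`.
[cite: TillichZemor2014, §3 (arXiv v1 chunk p0006 L35-39)] -/
theorem mem_rowSpace_iff (H : Matrix r q F) (x : q → F) : x ∈ rowSpace H ↔ ∃ y, y ᵥ* H = x := by
  simp [rowSpace]

/-- The **minimum distance of the CSS code** with check matrices `H_X`, `H_Z` (length = the column index
type `q`), as printed: "the minimum weight of the non-zero vectors that are either in `C_X` but not in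
`C_Z^⊥` or in `C_Z` but not in `C_X^⊥`", where `C_X`, `C_Z` are the codes with parity-check matrices
`H_X`, `H_Z` and `C_X^⊥`, `C_Z^⊥` their row spaces; an extended natural number, `⊤` when no such vector
exists (the paper's convention "the minimum distance of a code reduced to the all-zero codeword is `∞`",
§5). Non-zeroness is automatic (`0` lies in every row space) and is not repeated. Definition.
[cite: TillichZemor2014, §2 (arXiv v1 chunk p0004 L9-18) and §5 (chunk p0008 L3-4)] -/
noncomputable def cssMinDist (HX : Matrix r q F) (HZ : Matrix r' q F) : ℕ∞ :=
  ⨅ (e : q → F) (_ : (e ∈ pcCode HX ∧ e ∉ rowSpace HZ) ∨ (e ∈ pcCode HZ ∧ e ∉ rowSpace HX)),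
    (hammingNorm e : ℕ∞)

/-- Unfolding lemma: `D ≤ cssMinDist HX HZ` iff every vector of `ker H_X ∖ rowsp H_Z` and every vector of
`ker H_Z ∖ rowsp H_X` has weight `≥ D`. [cite: TillichZemor2014, §2 (arXiv v1 chunk p0004 L9-18)] -/
theorem le_cssMinDist_iff {HX : Matrix r q F} {HZ : Matrix r' q F} {D : ℕ∞} :
    D ≤ cssMinDist HX HZ ↔ ∀ e : q → F,
      ((e ∈ pcCode HX ∧ e ∉ rowSpace HZ) ∨ (e ∈ pcCode HZ ∧ e ∉ rowSpace HX)) →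
        D ≤ (hammingNorm e : ℕ∞) := by
  simp only [cssMinDist, le_iInf_iff]

/-- A vector of `ker H_X ∖ rowsp H_Z` or of `ker H_Z ∖ rowsp H_X` bounds the CSS minimum distance from
above by its weight. [cite: TillichZemor2014, §2 (arXiv v1 chunk p0004 L9-18)] -/
theorem cssMinDist_le_hammingNorm {HX : Matrix r q F} {HZ : Matrix r' q F} {e : q → F}
    (he : (e ∈ pcCode HX ∧ e ∉ rowSpace HZ) ∨ (e ∈ pcCode HZ ∧ e ∉ rowSpace HX)) :
    cssMinDist HX HZ ≤ (hammingNorm e : ℕ∞) :=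
  le_cssMinDist_iff.1 le_rfl e he

/-- The CSS minimum distance is symmetric in the two check matrices (exchanging the roles of `X` and `Z`).
[cite: TillichZemor2014, §2 (arXiv v1 chunk p0004 L9-18)] -/
theorem cssMinDist_comm (HX : Matrix r q F) (HZ : Matrix r' q F) :
    cssMinDist HX HZ = cssMinDist HZ HX := by
  refine le_antisymm (le_cssMinDist_iff.2 fun e he => cssMinDist_le_hammingNorm he.symm)
    (le_cssMinDist_iff.2 fun e he => cssMinDist_le_hammingNorm he.symm)

end CSS

/-! ### The product hypergraph `ℋ₁·ℋ₂` and its quantum code `Q_ℋ` (TZ §§3–4) -/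

namespace HypergraphProduct

variable {V₁ E₁ V₂ E₂ : Type*}
variable [Fintype V₁] [Fintype E₁] [Fintype V₂] [Fintype E₂]
variable [DecidableEq V₁] [DecidableEq E₁] [DecidableEq V₂] [DecidableEq E₂]

/-- `H_X` of the quantum code `Q_ℋ`, `ℋ = ℋ₁·ℋ₂`: the vertex–edge incidence matrix of the product
hypergraph. Vertices `V₁ × V₂`; edges `(E₁ × V₂) ⊕ (V₁ × E₂)` ("`E_R`": the edges
`αb = {x₁b, …, x_u b}`, `α = {x₁,…,x_u} ∈ E₁`, `b ∈ V₂` — the paper indexes `E_R` by `V₂ × E₁`, we write the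
pair as `(α, b)` so that the block is a plain Kronecker product; "`E_L`": the edges `aβ`, `a ∈ V₁`,
`β ∈ E₂`); vertex `ab` lies on `αb'` iff `a ∈ α` and `b = b'`, and on `a'β` iff `a = a'` and `b ∈ β` —
i.e. the block matrix `[H₁ ⊗ 1 | 1 ⊗ H₂]` (Kovalev–Pryadko eq. (7): `G_X = (E₂ ⊗ ℋ₁, ℋ₂ ⊗ E₁)`, the same
matrix with the Kronecker factors listed in the other order). Computable; definition.
[cite: TillichZemor2014, §3-§4 (arXiv v1 chunk p0006 L56-74, p0007 L1-8)] -/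
def xMatrix (H₁ : Matrix V₁ E₁ (ZMod 2)) (H₂ : Matrix V₂ E₂ (ZMod 2)) :
    Matrix (V₁ × V₂) ((E₁ × V₂) ⊕ (V₁ × E₂)) (ZMod 2) :=
  Matrix.fromCols (H₁ ⊗ₖ (1 : Matrix V₂ V₂ (ZMod 2))) ((1 : Matrix V₁ V₁ (ZMod 2)) ⊗ₖ H₂)

/-- `H_Z` of the quantum code `Q_ℋ`, `ℋ = ℋ₁·ℋ₂`: the chamber–edge incidence matrix. The chamber of the
pair of edges `(α, β) ∈ E₁ × E₂` is `C_{αβ} = {α y : y ∈ β} ∪ {x β : x ∈ α}` (`|C_{αβ}| = |α| + |β|`), i.e.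
row `(α,β)` has a `1` in column `α'b` iff `α' = α ∧ b ∈ β` and in column `aβ'` iff `a ∈ α ∧ β' = β` — the
block matrix `[1 ⊗ H₂ᵀ | H₁ᵀ ⊗ 1]` (Kovalev–Pryadko eq. (7): `G_Z = (ℋ₂ᵀ ⊗ Ẽ₁, Ẽ₂ ⊗ ℋ₁ᵀ)`).
Computable; definition. [cite: TillichZemor2014, §3-§4 (arXiv v1 chunk p0006 L82-90, p0007 L1-8)] -/
def zMatrix (H₁ : Matrix V₁ E₁ (ZMod 2)) (H₂ : Matrix V₂ E₂ (ZMod 2)) :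
    Matrix (E₁ × E₂) ((E₁ × V₂) ⊕ (V₁ × E₂)) (ZMod 2) :=
  Matrix.fromCols ((1 : Matrix E₁ E₁ (ZMod 2)) ⊗ₖ H₂ᵀ) (H₁ᵀ ⊗ₖ (1 : Matrix E₂ E₂ (ZMod 2)))

omit [Fintype V₁] [Fintype E₁] [Fintype V₂] [Fintype E₂] [DecidableEq E₁] [DecidableEq E₂] in
/-- Entry formula for `H_X` on an edge of type `E_R` (`αb'`): vertex `(a,b)` is incident iff `a ∈ α` and
`b = b'`. [cite: TillichZemor2014, §3 (arXiv v1 chunk p0006 L67-70)] -/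
theorem xMatrix_apply_inl (H₁ : Matrix V₁ E₁ (ZMod 2)) (H₂ : Matrix V₂ E₂ (ZMod 2))
    (a : V₁) (b : V₂) (α : E₁) (b' : V₂) :
    xMatrix H₁ H₂ (a, b) (Sum.inl (α, b')) = H₁ a α * (if b = b' then 1 else 0) := by
  simp [xMatrix, Matrix.one_apply]

omit [Fintype V₁] [Fintype E₁] [Fintype V₂] [Fintype E₂] [DecidableEq E₁] [DecidableEq E₂] in
/-- Entry formula for `H_X` on an edge of type `E_L` (`a'β`): vertex `(a,b)` is incident iff `a = a'` and
`b ∈ β`. [cite: TillichZemor2014, §3 (arXiv v1 chunk p0006 L62-66)] -/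
theorem xMatrix_apply_inr (H₁ : Matrix V₁ E₁ (ZMod 2)) (H₂ : Matrix V₂ E₂ (ZMod 2))
    (a : V₁) (b : V₂) (a' : V₁) (β : E₂) :
    xMatrix H₁ H₂ (a, b) (Sum.inr (a', β)) = (if a = a' then 1 else 0) * H₂ b β := by
  simp [xMatrix, Matrix.one_apply]

omit [Fintype V₁] [Fintype E₁] [Fintype V₂] [Fintype E₂] [DecidableEq V₁] [DecidableEq V₂] in
/-- Entry formula for `H_Z` on an edge of type `E_R` (`α'b`): it lies in the chamber `C_{αβ}` iff `α' = α`
and `b ∈ β`. [cite: TillichZemor2014, §3 (arXiv v1 chunk p0006 L82-87)] -/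
theorem zMatrix_apply_inl (H₁ : Matrix V₁ E₁ (ZMod 2)) (H₂ : Matrix V₂ E₂ (ZMod 2))
    (α : E₁) (β : E₂) (α' : E₁) (b : V₂) :
    zMatrix H₁ H₂ (α, β) (Sum.inl (α', b)) = (if α = α' then 1 else 0) * H₂ b β := by
  simp [zMatrix, Matrix.one_apply]

omit [Fintype V₁] [Fintype E₁] [Fintype V₂] [Fintype E₂] [DecidableEq V₁] [DecidableEq V₂] in
/-- Entry formula for `H_Z` on an edge of type `E_L` (`aβ'`): it lies in the chamber `C_{αβ}` iff `a ∈ α`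
and `β' = β`. [cite: TillichZemor2014, §3 (arXiv v1 chunk p0006 L82-87)] -/
theorem zMatrix_apply_inr (H₁ : Matrix V₁ E₁ (ZMod 2)) (H₂ : Matrix V₂ E₂ (ZMod 2))
    (α : E₁) (β : E₂) (a : V₁) (β' : E₂) :
    zMatrix H₁ H₂ (α, β) (Sum.inr (a, β')) = H₁ a α * (if β = β' then 1 else 0) := by
  simp [zMatrix, Matrix.one_apply]

/-- **TZ Proposition 3** (`C_Z^⊥ ⊂ Z(ℋ) = C_X`, "so that `C_X^⊥` and `C_Z^⊥` are mutually orthogonal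
subspaces which justifies the definition of the quantum code `Q_ℋ`"), in matrix form: `H_X H_Zᵀ = 0`
over `𝔽₂` (both block products equal `H₁ ⊗ H₂`, which cancel in characteristic `2`). Proved.
[cite: TillichZemor2014, Prop. 3 (arXiv v1 chunk p0007 L44-48)] -/
theorem xMatrix_mul_zMatrix_transpose (H₁ : Matrix V₁ E₁ (ZMod 2)) (H₂ : Matrix V₂ E₂ (ZMod 2)) :
    xMatrix H₁ H₂ * (zMatrix H₁ H₂)ᵀ = 0 := by
  rw [xMatrix, zMatrix, Matrix.transpose_fromCols, Matrix.fromCols_mul_fromRows,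
    ← Matrix.kroneckerMap_transpose, ← Matrix.kroneckerMap_transpose, Matrix.transpose_transpose,
    Matrix.transpose_transpose, Matrix.transpose_one, Matrix.transpose_one, ← Matrix.mul_kronecker_mul,
    ← Matrix.mul_kronecker_mul]
  simp only [Matrix.one_mul, Matrix.mul_one]
  ext i j
  rw [Matrix.add_apply, Matrix.zero_apply]
  generalize (H₁ ⊗ₖ H₂) i j = x
  revert x
  decide

/-- Every row of `H_Z` (every chamber) is a cycle of `ℋ`: `rowSpace H_Z ≤ ker H_X` (`C_Z^⊥ ⊂ C_X`).
Proved from `H_X H_Zᵀ = 0`. [cite: TillichZemor2014, Prop. 3 (arXiv v1 chunk p0007 L44-48)] -/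
theorem rowSpace_zMatrix_le (H₁ : Matrix V₁ E₁ (ZMod 2)) (H₂ : Matrix V₂ E₂ (ZMod 2)) :
    rowSpace (zMatrix H₁ H₂) ≤ pcCode (xMatrix H₁ H₂) := by
  rintro x ⟨y, rfl⟩
  change xMatrix H₁ H₂ *ᵥ (y ᵥ* zMatrix H₁ H₂) = 0
  rw [Matrix.mulVec_vecMul, xMatrix_mul_zMatrix_transpose, Matrix.zero_mulVec]

/-- Dually, every row of `H_X` (elementary cocycle) is orthogonal to `C_Z`: `rowSpace H_X ≤ ker H_Z`.
Proved. [cite: TillichZemor2014, Prop. 3 (arXiv v1 chunk p0007 L44-48)] -/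
theorem rowSpace_xMatrix_le (H₁ : Matrix V₁ E₁ (ZMod 2)) (H₂ : Matrix V₂ E₂ (ZMod 2)) :
    rowSpace (xMatrix H₁ H₂) ≤ pcCode (zMatrix H₁ H₂) := by
  rintro x ⟨y, rfl⟩
  change zMatrix H₁ H₂ *ᵥ (y ᵥ* xMatrix H₁ H₂) = 0
  rw [Matrix.mulVec_vecMul, ← Matrix.transpose_transpose (zMatrix H₁ H₂), ← Matrix.transpose_mul,
    xMatrix_mul_zMatrix_transpose, Matrix.transpose_zero, Matrix.zero_mulVec]

/-! ### The printed parameter statements (cited facts, D-0014) -/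

/-- **TZ Theorem 7 (dimension of `Q_ℋ`)**, as printed: with `k = dim Z(ℋ₁)`, `h = dim Z(ℋ₂)`,
`r = dim Z(ℋ₁ᵀ)`, `s = dim Z(ℋ₂ᵀ)`,
`dim Q_ℋ = 2rs + r(|E₂| − |V₂|) + s(|E₁| − |V₁|) = 2kh + k(|V₂| − |E₂|) + h(|V₁| − |E₁|)`,
where `dim Q_ℋ = |E| − dim C_X^⊥ − dim C_Z^⊥` (§2; `C_X^⊥`, `C_Z^⊥` = row spaces of `H_X`, `H_Z`, so their
dimensions are the ranks). Typed over `ℤ` (no truncated subtraction); both printed right-hand sides are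
asserted. Cited fact (statement only; the proof — Props. 5, 6 and eq. `(1)` `dim Z(ℋᵀ) = |V| − dim Z(ℋ)^⊥` —
is linear algebra not yet in the tree). [cite: TillichZemor2014, Thm 7 (arXiv v1 chunk p0007 L126-135)] -/
def dimension_eq : Prop :=
  ∀ (V₁ E₁ V₂ E₂ : Type) [Fintype V₁] [Fintype E₁] [Fintype V₂] [Fintype E₂]
    [DecidableEq V₁] [DecidableEq E₁] [DecidableEq V₂] [DecidableEq E₂]
    (H₁ : Matrix V₁ E₁ (ZMod 2)) (H₂ : Matrix V₂ E₂ (ZMod 2)),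
    let k : ℤ := Module.finrank (ZMod 2) (pcCode H₁)
    let h : ℤ := Module.finrank (ZMod 2) (pcCode H₂)
    let r : ℤ := Module.finrank (ZMod 2) (pcCode H₁ᵀ)
    let s : ℤ := Module.finrank (ZMod 2) (pcCode H₂ᵀ)
    let dimQ : ℤ := (Fintype.card ((E₁ × V₂) ⊕ (V₁ × E₂)) : ℤ)
      - (xMatrix H₁ H₂).rank - (zMatrix H₁ H₂).rank
    dimQ = 2 * r * s + r * (Fintype.card E₂ - Fintype.card V₂) + s * (Fintype.card E₁ - Fintype.card V₁)
    ∧ dimQ = 2 * k * h + k * (Fintype.card V₂ - Fintype.card E₂) + h * (Fintype.card V₁ - Fintype.card E₁)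

/-- **TZ Theorem 9 (minimum distance, lower bound)**, as printed: "The minimum distance `D` of the quantum
code `Q_ℋ` satisfies `D ≥ min(d₁, d₂, d₁ᵀ, d₂ᵀ)`", where `d₁, d₂` are the minimum distances of the cycle
codes `Z(ℋ₁)`, `Z(ℋ₂)` (codes with parity-check matrices `H₁`, `H₂`), `d₁ᵀ, d₂ᵀ` those of `Z(ℋ₁ᵀ)`,
`Z(ℋ₂ᵀ)` (parity-check matrices `H₁ᵀ`, `H₂ᵀ`), all with the convention that the distance of the zero
code is `∞` (= `⊤` of `Coding.minDist` / `cssMinDist`). An INEQUALITY: equality is not printed in general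
(see `minDist_le` for the printed upper bounds). Cited fact.
[cite: TillichZemor2014, Thm 9 (arXiv v1 chunk p0008 L1-15)] -/
def minDist_ge : Prop :=
  ∀ (V₁ E₁ V₂ E₂ : Type) [Fintype V₁] [Fintype E₁] [Fintype V₂] [Fintype E₂]
    [DecidableEq V₁] [DecidableEq E₁] [DecidableEq V₂] [DecidableEq E₂]
    (H₁ : Matrix V₁ E₁ (ZMod 2)) (H₂ : Matrix V₂ E₂ (ZMod 2)),
    min (min (Coding.minDist (pcCode H₁)) (Coding.minDist (pcCode H₂)))
        (min (Coding.minDist (pcCode H₁ᵀ)) (Coding.minDist (pcCode H₂ᵀ)))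
      ≤ cssMinDist (xMatrix H₁ H₂) (zMatrix H₁ H₂)

/-- **TZ Lemma 10 (minimum distance, upper bounds)**, as printed: "Suppose `d₁ < ∞` and `d₂ᵀ < ∞`. Then
`D ≤ d₁`. Similarly, if `d₂ < ∞` and `d₁ᵀ < ∞`. Then `D ≤ d₂`." (notation of Theorem 9; "the above bound is
exact, except for some degenerate cases"). Cited fact.
[cite: TillichZemor2014, Lemma 10 (arXiv v1 chunk p0008 L53-62)] -/
def minDist_le : Prop :=
  ∀ (V₁ E₁ V₂ E₂ : Type) [Fintype V₁] [Fintype E₁] [Fintype V₂] [Fintype E₂]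
    [DecidableEq V₁] [DecidableEq E₁] [DecidableEq V₂] [DecidableEq E₂]
    (H₁ : Matrix V₁ E₁ (ZMod 2)) (H₂ : Matrix V₂ E₂ (ZMod 2)),
    (Coding.minDist (pcCode H₁) < ⊤ → Coding.minDist (pcCode H₂ᵀ) < ⊤ →
        cssMinDist (xMatrix H₁ H₂) (zMatrix H₁ H₂) ≤ Coding.minDist (pcCode H₁))
    ∧ (Coding.minDist (pcCode H₂) < ⊤ → Coding.minDist (pcCode H₁ᵀ) < ⊤ →
        cssMinDist (xMatrix H₁ H₂) (zMatrix H₁ H₂) ≤ Coding.minDist (pcCode H₂))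

/-- **TZ Theorem 1 (main theorem; = §6)**, as printed: "Let `H` be a full-rank `(n−k) × n` parity-check
matrix of a classical LDPC code `C` of parameters `[n,k,d]`. There is a construction of a quantum LDPC code
with `H` as building block, of length `N = n² + (n−k)²`, dimension `k²`, and quantum minimum distance `d`."
The construction (§6) is `Q_ℋ` for `ℋ = ℋ₁·ℋ₂` with `ℋ₁` the hypergraph of `H` and `ℋ₂ = ℋ₁ᵀ`, i.e. the
check matrices `xMatrix H Hᵀ`, `zMatrix H Hᵀ` on the qubit set `(Fin n × Fin n) ⊕ (Fin m × Fin m)`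
(`N = n² + (n−k)²` is the cardinality of that index type, `m = n − k`). Typed with the paper's exact
hypotheses: `H : Matrix (Fin m) (Fin n) (ZMod 2)` has full (row) rank `m` ("full-rank, i.e. `n−k`" rows),
`k = dim C = dim ker H`, `d = ` the minimum distance of `C` (`⊤` if `C = 0`, in which case `k = 0` and the
quantum code has no logical operator either); conclusion: `N − rank H_X − rank H_Z = k²` (over `ℤ`) and
`D = d`. The row-weight clause ("row weights of the form `i+j`") is bookkeeping on `xMatrix`/`zMatrix` and is
not part of this Prop. Cited fact.
[cite: TillichZemor2014, Thm 1 (arXiv v1 chunk p0003 L71-80) and §6 (chunk p0009 L1-52)] -/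
def mainTheorem : Prop :=
  ∀ (m n : ℕ) (H : Matrix (Fin m) (Fin n) (ZMod 2)), H.rank = m →
    ((Fintype.card ((Fin n × Fin n) ⊕ (Fin m × Fin m)) : ℤ) - (xMatrix H Hᵀ).rank - (zMatrix H Hᵀ).rank
        = (Module.finrank (ZMod 2) (pcCode H) : ℤ) ^ 2
      ∧ cssMinDist (xMatrix H Hᵀ) (zMatrix H Hᵀ) = Coding.minDist (pcCode H))

end HypergraphProduct

/-- **The parameters of the hypergraph product (Tillich–Zémor 2014)** as one named fact: the conjunction of
the printed dimension theorem (Thm 7), distance lower bound (Thm 9: `D ≥ min(d₁,d₂,d₁ᵀ,d₂ᵀ)`) and distance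
upper bounds (Lemma 10) for the quantum code `Q_{ℋ₁·ℋ₂}` with check matrices
`HypergraphProduct.xMatrix H₁ H₂`, `HypergraphProduct.zMatrix H₁ H₂`. In the modern labelling `HGP(A,B)`
(`= Q_{ℋ_A·ℋ_Bᵀ}`, i.e. `H₁ = A`, `H₂ = Bᵀ`; see the module docstring for the dictionary) this is the
statement usually summarised as "`[[n_A n_B + m_A m_B, k_A k_B + k_Aᵀ k_Bᵀ, ≥ min(d_A, d_B, d_Aᵀ, d_Bᵀ)]]`";
the equality of the distance with that minimum is NOT part of the printed theorem (it fails when the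
code has no logical qubit) — only the inequality and Lemma 10's upper bounds are. Cited fact.
[cite: TillichZemor2014, Thm 7 (arXiv v1 chunk p0007 L126-135), Thm 9 (chunk p0008 L11-15), Lemma 10 (chunk p0008 L57-62)] -/
def TillichZemor2014_hgp_parameters : Prop :=
  HypergraphProduct.dimension_eq ∧ HypergraphProduct.minDist_ge ∧ HypergraphProduct.minDist_le

end Literature.InformationTheory.QuantumCodes
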